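import Literature.Topology.FourManifolds.ClosedAsCobordism
import Literature.Topology.FourManifolds.RegularSublevelSet

/-!
# A compact regular sublevel domain `{F ≤ 0} ⊆ ℝ^{m+1}` as a compact manifold with boundary
# `{F = 0}`, and as a cobordism from `∅` to its boundary

Topic `Literature/Topology/FourManifolds` (infrastructure for the fact seat
`provefact-Literature.Geometry.Riemannian.LawsonMichelsohn1984_surrounding`,
`Literature/Geometry/Riemannian/MeanConvexSurrounding.lean`, and for every statement of the tree
written in the *level-set idiom* of compact domains in Euclidean space — a smooth
`F : ℝ^{m+1} → ℝ` with `{F ≤ 0}` compact and `dF ≠ 0` on `{F = 0}`, e.g. the `SmoothPoincare4`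
route `ConvexityLadder` and `HuiskenSinestrari2009_twoConvex_simplyConnected`).  Everything here
is **proved**; no named fact is introduced.

**The statement formalised** (Lee, *Introduction to Smooth Manifolds* (2013), Prop. 5.47: *if
`f` is a smooth real-valued function on `M` and `b` a regular value, `f⁻¹(-∞, b]` is a regular
domain*, i.e. a properly embedded codimension-`0` submanifold with boundary, whose boundary is
`f⁻¹(b)`; Milnor, *Morse theory* (1963), Thm. 3.1 / *Lectures on the h-cobordism theorem*
(1965), Lemma 2.9 and Def. 1.1 for the cobordism reading).  For `F : ℝ^{m+1} → ℝ` smooth with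
`{F ≤ 0}` compact and `dF(x) ≠ 0` whenever `F x = 0` (`IsRegularCompactDomain F`):

* `IsRegularCompactDomain.Domain h` — the type `{F ≤ 0}`, a compact Hausdorff second-countable
  `C^∞` manifold with boundary modelled on `𝓡∂ (m + 1)` (`instChartedSpace`, `instIsManifold`,
  `instCompactSpace`), whose boundary points are exactly the zeros of `F`
  (`isBoundaryPoint_iff`, `mem_boundary_iff`) and whose interior points are the points with
  `F < 0` (`isInteriorPoint_iff`); the inclusion `incl : h.Domain → ℝ^{m+1}` is a topological
  embedding with range `{F ≤ 0}`, smooth for `m ≥ 1` (`contMDiff_incl`).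
* `IsRegularCompactDomain.cobordism h : Cobordism m PEmpty (∂ h.Domain)` — the domain as a
  cobordism from the empty manifold to its boundary (the tree's `Cobordism`, `Cobordism.lean`),
  so that the Morse–Smale theory vendored for cobordisms (Morse functions `Cobordism.lean` /
  `Handles.lean`, handle decompositions, Milnor's rearrangement and cancellation theorems)
  applies to compact domains of Euclidean space; `range_incl_comp_val_boundary`: the boundary is
  carried by `incl` onto the zero set `{F = 0}`.

## Construction

No new charts are built: `ℝ^{m+1}` is re-charted on the half-space by the tree's synonym
`HalfSpaceCharted ℝ^{m+1}` (`ClosedAsCobordism.lean`: a boundaryless `𝓡∂ (m + 1)`-manifold on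
the same type, with the same smooth functions and the same critical points, `contMDiff_iff`,
`isMCriticalPt_iff'`), on which `{F ≤ 0}` is a regular sublevel set in the interior, so that
the half-slice atlas `sublevelAtlas` of `RegularSublevelSet.lean` (Milnor 1965, Lemma 2.9)
applies verbatim; the boundary of a `C^∞` manifold with boundary is a closed manifold smoothly
embedded by the inclusion (`BoundaryManifold`, `Cobordism.lean`, Lee Thm. 5.11), which gives the
outgoing end of the cobordism, the incoming end being `PEmpty` as in `Cobordism.ofClosed`.

## References

* J. M. Lee, *Introduction to Smooth Manifolds*, 2nd ed., GTM 218 (2013), Prop. 5.47,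
  Thm. 5.11. [LeeSmoothManifolds2013]
* J. Milnor, *Lectures on the h-cobordism theorem*, Princeton (1965), Def. 1.1, Lemma 2.9.
  [MilnorHCobordism1965]
-/

open scoped Manifold ContDiff Topology
open Set Function

noncomputable section

namespace Literature.Topology.FourManifolds

/-- Local notation: `𝔼 n` is the model Euclidean space `EuclideanSpace ℝ (Fin n)`. -/
local notation "𝔼 " n:arg => EuclideanSpace ℝ (Fin n)
/-- Local notation: `ℍ n` is the closed half-space `EuclideanHalfSpace n`. -/
local notation "ℍ " n:arg => EuclideanHalfSpace n

variable {m : ℕ}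

/-- **A compact regular sublevel domain of `ℝ^{m+1}` in the level-set idiom**: `F` is smooth,
`{F ≤ 0}` is compact, and `dF(x) ≠ 0` at every zero `x` of `F` (so `{F = 0}` is a regular level
bounding the compact domain `{F ≤ 0}`; Lee 2013, Prop. 5.47).  This is the conjunction of the
three hypotheses under which the tree's Euclidean level-set statements are written.
[cite: LeeSmoothManifolds2013, Prop. 5.47] -/
structure IsRegularCompactDomain (F : 𝔼 (m + 1) → ℝ) : Prop where
  /-- `F` is smooth. -/
  contDiff : ContDiff ℝ ∞ F
  /-- The sublevel set `{F ≤ 0}` is compact. -/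
  isCompact : IsCompact {x | F x ≤ 0}
  /-- `0` is a regular value of `F` on its zero set. -/
  fderiv_ne_zero : ∀ x, F x = 0 → fderiv ℝ F x ≠ 0

namespace IsRegularCompactDomain

open HalfSpaceCharted

variable {F : 𝔼 (m + 1) → ℝ}

/-! ### `{F ≤ 0}` as a regular sublevel set of the half-space-charted `ℝ^{m+1}` -/

/-- `F` is continuous. [folklore] -/
theorem continuous (h : IsRegularCompactDomain F) : Continuous F := h.contDiff.continuous

/-- `F`, read on `HalfSpaceCharted ℝ^{m+1}`, is smooth for the model `𝓡∂ (m + 1)`. [folklore] -/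
theorem contMDiff_comp_symm (h : IsRegularCompactDomain F) :
    ContMDiff (𝓡∂ (m + 1)) 𝓘(ℝ, ℝ) ∞ (F ∘ (of (X := 𝔼 (m + 1))).symm) :=
  contMDiff_iff.2 h.contDiff.contMDiff

/-- A zero of `F` is not a critical point of `F` read on `HalfSpaceCharted ℝ^{m+1}`. [folklore] -/
theorem not_isMCriticalPt (h : IsRegularCompactDomain F)
    (q : HalfSpaceCharted (𝔼 (m + 1))) (hq : (F ∘ of.symm) q = 0) :
    ¬ IsMCriticalPt (𝓡∂ (m + 1)) (F ∘ (of (X := 𝔼 (m + 1))).symm) q := by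
  rw [isMCriticalPt_iff']
  intro hc
  apply h.fderiv_ne_zero (of.symm q) hq
  have : mfderiv (𝓡 (m + 1)) 𝓘(ℝ, ℝ) F (of.symm q) = 0 := hc
  rwa [_root_.mfderiv_eq_fderiv] at this

/-- Every point of the boundaryless `HalfSpaceCharted ℝ^{m+1}` is an interior point. [folklore] -/
theorem isInteriorPoint_halfSpaceCharted (q : HalfSpaceCharted (𝔼 (m + 1))) :
    (𝓡∂ (m + 1)).IsInteriorPoint q :=
  BoundarylessManifold.isInteriorPoint

/-- **The half-slice atlas of the domain**: `sublevelAtlas` (Milnor 1965, Lemma 2.9) for `F`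
read on `HalfSpaceCharted ℝ^{m+1}` at the level `0`. [cite: MilnorHCobordism1965, Lemma 2.9] -/
def atlas (h : IsRegularCompactDomain F) :
    HalfSliceAtlas (𝓡∂ (m + 1)) ((F ∘ (of (X := 𝔼 (m + 1))).symm) ⁻¹' Iic 0) :=
  sublevelAtlas h.contMDiff_comp_symm 0 (fun q _ => isInteriorPoint_halfSpaceCharted q)
    (fun q hq => h.not_isMCriticalPt q hq)

end IsRegularCompactDomain

/-- **The compact domain `{F ≤ 0}` as a type** (the subtype of `HalfSpaceCharted ℝ^{m+1}`), for
`h : IsRegularCompactDomain F`; it carries the structure of a compact `C^∞` manifold with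
boundary (Lee 2013, Prop. 5.47). [cite: LeeSmoothManifolds2013, Prop. 5.47] -/
def IsRegularCompactDomain.Domain {F : 𝔼 (m + 1) → ℝ} (_h : IsRegularCompactDomain F) : Type :=
  ↥((F ∘ (HalfSpaceCharted.of (X := 𝔼 (m + 1))).symm) ⁻¹' Iic 0)

namespace IsRegularCompactDomain

open HalfSpaceCharted

variable {F : 𝔼 (m + 1) → ℝ}

namespace Domain

/-- The subspace topology on the domain. [folklore] -/
instance instTopologicalSpace (h : IsRegularCompactDomain F) : TopologicalSpace h.Domain :=
  inferInstanceAs (TopologicalSpace ↥((F ∘ (of (X := 𝔼 (m + 1))).symm) ⁻¹' Iic 0))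

/-- The inclusion of the domain into `ℝ^{m+1}`. [folklore] -/
def incl (h : IsRegularCompactDomain F) : h.Domain → 𝔼 (m + 1) := fun p => of.symm p.1

/-- The point of the domain given by `x` with `F x ≤ 0`. [folklore] -/
def mk (h : IsRegularCompactDomain F) (x : 𝔼 (m + 1)) (hx : F x ≤ 0) : h.Domain := ⟨of x, hx⟩

/-- `incl ∘ mk = id` on points (definitional). [folklore] -/
@[simp] theorem incl_mk (h : IsRegularCompactDomain F)
    (x : 𝔼 (m + 1)) (hx : F x ≤ 0) : incl h (mk h x hx) = x := rfl

/-- `mk ∘ incl = id` (definitional up to eta). [folklore] -/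
@[simp] theorem mk_incl (h : IsRegularCompactDomain F)
    (p : h.Domain) : mk h (incl h p) p.2 = p := rfl

/-- Points of the domain have `F ≤ 0`. [folklore] -/
theorem apply_incl_nonpos (h : IsRegularCompactDomain F) (p : h.Domain) : F (incl h p) ≤ 0 := p.2

/-- The image of the inclusion is `{F ≤ 0}`. [folklore] -/
theorem range_incl (h : IsRegularCompactDomain F) : range (incl h) = {x | F x ≤ 0} := by
  ext x
  exact ⟨fun ⟨p, hp⟩ => hp ▸ apply_incl_nonpos h p, fun hx => ⟨mk h x hx, rfl⟩⟩

/-- The inclusion is injective. [folklore] -/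
theorem injective_incl (h : IsRegularCompactDomain F) :
    Injective (incl h) := fun _ _ hpq => Subtype.ext hpq

/-- The inclusion is a topological embedding. [folklore] -/
theorem isEmbedding_incl (h : IsRegularCompactDomain F) :
    Topology.IsEmbedding (incl h) := Topology.IsEmbedding.subtypeVal

/-- The inclusion is continuous. [folklore] -/
theorem continuous_incl (h : IsRegularCompactDomain F) :
    Continuous (incl h) := continuous_subtype_val

/-- Two points of the domain with the same image coincide. [folklore] -/
theorem incl_inj (h : IsRegularCompactDomain F)
    {p q : h.Domain} : incl h p = incl h q ↔ p = q := (injective_incl h).eq_iff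

/-- The domain is Hausdorff. [folklore] -/
instance instT2Space (h : IsRegularCompactDomain F) : T2Space h.Domain :=
  inferInstanceAs (T2Space ↥((F ∘ (of (X := 𝔼 (m + 1))).symm) ⁻¹' Iic 0))

/-- The domain is second countable. [folklore] -/
instance instSecondCountableTopology (h : IsRegularCompactDomain F) :
    SecondCountableTopology h.Domain :=
  inferInstanceAs (SecondCountableTopology ↥((F ∘ (of (X := 𝔼 (m + 1))).symm) ⁻¹' Iic 0))

/-- The domain is compact. [folklore] -/
instance instCompactSpace (h : IsRegularCompactDomain F) : CompactSpace h.Domain :=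
  isCompact_iff_compactSpace.1
    (h.isCompact : IsCompact ((F ∘ (of (X := 𝔼 (m + 1))).symm) ⁻¹' Iic 0))

/-- A nonempty zero set makes the domain nonempty. [folklore] -/
theorem nonempty_of_exists_eq_zero (h : IsRegularCompactDomain F)
    (hZ : ∃ x, F x = 0) : Nonempty h.Domain := by
  obtain ⟨x, hx⟩ := hZ
  exact ⟨mk h x hx.le⟩

/-- **The domain is a smooth manifold with boundary, charts** (Lee 2013, Prop. 5.47; Milnor
1965, Lemma 2.9). [cite: LeeSmoothManifolds2013, Prop. 5.47] -/
instance instChartedSpace (h : IsRegularCompactDomain F) :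
    ChartedSpace (ℍ (m + 1)) h.Domain := h.atlas.chartedSpace

/-- **The domain is a smooth manifold with boundary, compatibility** (Lee 2013, Prop. 5.47;
Milnor 1965, Lemma 2.9). [cite: LeeSmoothManifolds2013, Prop. 5.47] -/
instance instIsManifold (h : IsRegularCompactDomain F) :
    IsManifold (𝓡∂ (m + 1)) ∞ h.Domain := h.atlas.isManifold

/-- The preferred chart of the domain at `p` is induced by the half-slice chart at `p`
(definitional). [folklore] -/
theorem chartAt_eq (h : IsRegularCompactDomain F)
    (p : h.Domain) : chartAt (ℍ (m + 1)) p = (h.atlas.datum p).chart p := rfl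

/-- **The boundary of the domain is the zero set**: `p` is a boundary point iff `F p = 0`
(Lee 2013, Prop. 5.47; Milnor 1963, Thm. 3.1). [cite: LeeSmoothManifolds2013, Prop. 5.47] -/
theorem isBoundaryPoint_iff (h : IsRegularCompactDomain F) (p : h.Domain) :
    (𝓡∂ (m + 1)).IsBoundaryPoint p ↔ F (incl h p) = 0 :=
  isBoundaryPoint_sublevel_iff h.contMDiff_comp_symm 0
    (fun q _ => isInteriorPoint_halfSpaceCharted q) (fun q hq => h.not_isMCriticalPt q hq) p

/-- **The interior of the domain is `{F < 0}`.** [cite: LeeSmoothManifolds2013, Prop. 5.47] -/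
theorem isInteriorPoint_iff (h : IsRegularCompactDomain F) (p : h.Domain) :
    (𝓡∂ (m + 1)).IsInteriorPoint p ↔ F (incl h p) < 0 :=
  isInteriorPoint_sublevel_iff h.contMDiff_comp_symm 0
    (fun q _ => isInteriorPoint_halfSpaceCharted q) (fun q hq => h.not_isMCriticalPt q hq) p

/-- Membership in the boundary of the domain. [cite: LeeSmoothManifolds2013, Prop. 5.47] -/
theorem mem_boundary_iff (h : IsRegularCompactDomain F) (p : h.Domain) :
    p ∈ (𝓡∂ (m + 1)).boundary h.Domain ↔ F (incl h p) = 0 :=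
  isBoundaryPoint_iff h p

/-- The boundary of the domain is the preimage of the zero set under the inclusion.
[cite: LeeSmoothManifolds2013, Prop. 5.47] -/
theorem boundary_eq (h : IsRegularCompactDomain F) :
    (𝓡∂ (m + 1)).boundary h.Domain = incl h ⁻¹' {x | F x = 0} :=
  Set.ext fun p => mem_boundary_iff h p

/-- **The boundary of the domain is carried by the inclusion onto the zero set `{F = 0}`.**
[cite: LeeSmoothManifolds2013, Prop. 5.47] -/
theorem range_incl_comp_val_boundary (h : IsRegularCompactDomain F) :
    range (fun p : (𝓡∂ (m + 1)).boundary h.Domain => incl h p.1) = {x | F x = 0} := by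
  ext x
  constructor
  · rintro ⟨p, rfl⟩
    exact (mem_boundary_iff h p.1).1 p.2
  · intro hx
    exact ⟨⟨mk h x hx.le, (mem_boundary_iff h _).2 hx⟩, rfl⟩

/-- The interior `{F < 0}` of the domain is the image of its interior points. [folklore] -/
theorem range_incl_comp_val_interior (h : IsRegularCompactDomain F) :
    range (fun p : (𝓡∂ (m + 1)).interior h.Domain => incl h p.1) = {x | F x < 0} := by
  ext x
  constructor
  · rintro ⟨p, rfl⟩
    exact (isInteriorPoint_iff h p.1).1 p.2
  · intro hx
    exact ⟨⟨mk h x hx.le, (isInteriorPoint_iff h _).2 hx⟩, rfl⟩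

/-! ### Smoothness of the inclusion -/

/-- The identity `HalfSpaceCharted ℝ^{m+1} → ℝ^{m+1}` is smooth. [folklore] -/
theorem contMDiff_of_symm :
    ContMDiff (𝓡∂ (m + 1)) (𝓡 (m + 1)) ∞ (of (X := 𝔼 (m + 1))).symm :=
  (contMDiff_iff (n := m) (X := 𝔼 (m + 1)) (F := 𝔼 (m + 1)) (f := id)).2 contMDiff_id

/-- **The inclusion of the domain into `ℝ^{m+1}` is smooth** (dimension `m + 1 ≥ 2`).
[cite: LeeSmoothManifolds2013, Prop. 5.47] -/
theorem contMDiff_incl (h : IsRegularCompactDomain F)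
    (hm : 1 ≤ m) : ContMDiff (𝓡∂ (m + 1)) (𝓡 (m + 1)) ∞ (incl h) :=
  (contMDiff_of_symm).comp (h.atlas.contMDiff_subtype_val hm)

/-- The inclusion of the domain into `HalfSpaceCharted ℝ^{m+1}` is a smooth embedding of
manifolds with boundary of the same dimension `m + 1 ≥ 2`.
[cite: LeeSmoothManifolds2013, Prop. 5.47] -/
theorem isSmoothEmbedding_subtype_val (h : IsRegularCompactDomain F) (hm : 1 ≤ m) :
    Manifold.IsSmoothEmbedding (𝓡∂ (m + 1)) (𝓡∂ (m + 1)) ∞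
      (fun p : h.Domain => (p.1 : HalfSpaceCharted (𝔼 (m + 1)))) :=
  h.atlas.isSmoothEmbedding_subtype_val hm

/-- `F ∘ incl` is smooth on the domain. [folklore] -/
theorem contMDiff_comp_incl (h : IsRegularCompactDomain F)
    (hm : 1 ≤ m) : ContMDiff (𝓡∂ (m + 1)) 𝓘(ℝ, ℝ) ∞ (F ∘ incl h) :=
  h.contDiff.contMDiff.comp (contMDiff_incl h hm)

/-! ### The boundary manifold and the cobordism `(D; ∅, ∂D)` -/

/-- The boundary `∂D` of the domain is compact. [folklore] -/
instance instCompactSpaceBoundary (h : IsRegularCompactDomain F) :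
    CompactSpace ((𝓡∂ (m + 1)).boundary h.Domain) :=
  isCompact_iff_compactSpace.1
    ((𝓡∂ (m + 1)).isClosed_boundary (M := h.Domain) (n := ∞) (by simp)).isCompact

/-- The boundary `∂D` is nonempty as soon as `F` has a zero. [folklore] -/
theorem nonempty_boundary (h : IsRegularCompactDomain F)
    (hZ : ∃ x, F x = 0) : Nonempty ((𝓡∂ (m + 1)).boundary h.Domain) := by
  obtain ⟨x, hx⟩ := hZ
  exact ⟨⟨mk h x hx.le, (mem_boundary_iff h _).2 hx⟩⟩

/-- `incl` restricted to the boundary is injective. [folklore] -/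
theorem injective_incl_comp_val_boundary (h : IsRegularCompactDomain F) :
    Injective fun p : (𝓡∂ (m + 1)).boundary h.Domain => incl h p.1 :=
  (injective_incl h).comp Subtype.val_injective

/-- `incl` restricted to the boundary is a topological embedding. [folklore] -/
theorem isEmbedding_incl_comp_val_boundary (h : IsRegularCompactDomain F) :
    Topology.IsEmbedding fun p : (𝓡∂ (m + 1)).boundary h.Domain => incl h p.1 :=
  (isEmbedding_incl h).comp Topology.IsEmbedding.subtypeVal

/-- **The boundary of the domain is homeomorphic to the zero set `{F = 0}`** (with their
subspace topologies), by the inclusion. [cite: LeeSmoothManifolds2013, Prop. 5.47] -/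
def boundaryHomeomorph (h : IsRegularCompactDomain F) :
    (𝓡∂ (m + 1)).boundary h.Domain ≃ₜ {x : 𝔼 (m + 1) // F x = 0} :=
  ((isEmbedding_incl_comp_val_boundary h).toHomeomorph).trans
    (Homeomorph.setCongr (range_incl_comp_val_boundary h))

/-- The homeomorphism `∂D ≃ₜ {F = 0}` is the inclusion on points. [folklore] -/
@[simp] theorem coe_boundaryHomeomorph_apply (h : IsRegularCompactDomain F)
    (p : (𝓡∂ (m + 1)).boundary h.Domain) :
    (boundaryHomeomorph h p : 𝔼 (m + 1)) = incl h p.1 := rfl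

end Domain

/-- **A compact regular domain of `ℝ^{m+1}` is a cobordism from `∅` to its boundary** (Milnor
1965, Def. 1.1: the triad `(D; ∅, ∂D)`; Lee 2013, Prop. 5.47 and Thm. 5.11): total space the
domain `{F ≤ 0}`, incoming end `PEmpty`, outgoing end the boundary manifold `∂D ≅ {F = 0}`
embedded by the inclusion. [cite: MilnorHCobordism1965, Def. 1.1 with Lemma 2.9] -/
def cobordism (h : IsRegularCompactDomain F) :
    Cobordism m PEmpty.{1} ((𝓡∂ (m + 1)).boundary h.Domain) where
  W := h.Domain
  inl := PEmpty.elim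
  inr := Subtype.val
  isSmoothEmbedding_inl :=
    ⟨⟨PUnit, inferInstance, inferInstance, fun x => x.elim⟩, .of_subsingleton _⟩
  isSmoothEmbedding_inr := BoundaryManifold.isSmoothEmbedding_subtype_val
  disjoint_range := by simp [Set.range_eq_empty]
  range_inl_union_range_inr := by simp [Set.range_eq_empty]

/-- The total space of the cobordism `(D; ∅, ∂D)` is the domain (definitional). [folklore] -/
@[simp] theorem cobordism_W (h : IsRegularCompactDomain F) : h.cobordism.W = h.Domain := rfl

/-- The outgoing end of `(D; ∅, ∂D)` is the inclusion of the boundary (definitional).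
[folklore] -/
@[simp] theorem cobordism_inr (h : IsRegularCompactDomain F) (p : (𝓡∂ (m + 1)).boundary h.Domain) :
    h.cobordism.inr p = (p : h.Domain) := rfl

/-- The range of the outgoing end of `(D; ∅, ∂D)` is the whole boundary. [folklore] -/
theorem range_cobordism_inr (h : IsRegularCompactDomain F) :
    range h.cobordism.inr = (𝓡∂ (m + 1)).boundary h.Domain :=
  Subtype.range_val

/-- The incoming end of `(D; ∅, ∂D)` is empty. [folklore] -/
theorem range_cobordism_inl (h : IsRegularCompactDomain F) :
    range h.cobordism.inl = ∅ := Set.range_eq_empty _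

end IsRegularCompactDomain

end Literature.Topology.FourManifolds

end
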